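import Mathlib
import Summits.ResolutionOfSingularities.ResolutionOfSingularities.Theorems.ShadowGameWin.Negative.Mirror

/-!
# The dictionary move ↔ substitution — stub `stub_dictionary` of line `refutation-cuspidal-edge` (crux stmt-ResolutionOfSingularities-18182, route ShadowGame)

One move `step p F i τ` of the shadow game (blow up `bl`, divide `dv` by `u_i^s`, translate `tr`,
clean), acting on the coefficient function of a CLEAN series `f`, is honest power-series algebra:
if `f(a) = u_i^s · g` for B's substitution `a : u_i ↦ u_i, u_j ↦ u_i (u_j + τ_j) (j ∈ F ∖ i),
u_k ↦ u_k`, then `step p F i τ (coeff f) = clean p (coeff g)`.  The heart is the identity (KEY)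
`tr F i τ s (dv i s (bl F i (coeff φ))) B = coeff_{B + s e_i} (φ(a))` for every series `φ`
(`tr_dv_bl_apply`): the right-hand side is expanded with `MvPowerSeries.coeff_subst`, the
coefficient of `∏_j a_j^{d_j}` at `B + s e_i` is computed in closed form through the binomial
theorem (`coeff_prod_X_pow_mul_X_add_C_pow`), and the resulting finite sum is re-indexed by
`D ↦ A_D = (B + D) with i-th entry B_i + s - Σ_{j ∈ F∖i} (B_j + D_j)`
(`exists_of_coeff_prod_ne_zero`, `injOn_exponent`, `dv_bl_mul_prod_eq`).  Finally
`coeff_{B + s e_i} (u_i^s g) = coeff_B g`.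
-/

noncomputable section

set_option linter.dupNamespace false

namespace Summit.ResolutionOfSingularities.ResolutionOfSingularities.Theorems.ShadowGameWinR.Negative

open Summit.ResolutionOfSingularities.ResolutionOfSingularities.Theorems.ShadowGameWin.Negative
  (clean bl mF dv tr step)
open MvPowerSeries

section Monomials

variable {σ : Type*} {R : Type*} [CommSemiring R]

/-- Binomial expansion of `(X_i^b (X_j + t))^n` as a sum of monomials. [folklore] -/
theorem X_pow_mul_X_add_C_pow (i j : σ) (b : ℕ) (t : R) (n : ℕ) :
    ((X i : MvPowerSeries σ R) ^ b * (X j + C t)) ^ n =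
      ∑ m ∈ Finset.range (n + 1), monomial (Finsupp.single i (b * n) + Finsupp.single j m)
        (t ^ (n - m) * (n.choose m : R)) := by
  rw [mul_pow, ← pow_mul, add_pow, Finset.mul_sum]
  refine Finset.sum_congr rfl fun m _ => ?_
  rw [X_pow_eq, X_pow_eq, ← map_pow, ← map_natCast (C : R →+* MvPowerSeries σ R),
    ← monomial_zero_eq_C_apply, ← monomial_zero_eq_C_apply, monomial_mul_monomial,
    monomial_mul_monomial, monomial_mul_monomial, add_zero, add_zero, one_mul, one_mul]

variable [Fintype σ] [DecidableEq σ]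

/-- The product `∏_j (X_i^{β_j} (X_j + t_j))^{d_j}` as an explicit sum of monomials. [folklore] -/
theorem prod_X_pow_mul_X_add_C_pow (i : σ) (β : σ → ℕ) (t : σ → R) (d : σ → ℕ) :
    ∏ j, ((X i : MvPowerSeries σ R) ^ β j * (X j + C (t j))) ^ d j =
      ∑ M ∈ Fintype.piFinset (fun j => Finset.range (d j + 1)),
        monomial (Finsupp.single i (∑ j, β j * d j) + Finsupp.equivFunOnFinite.symm M)
          (∏ j, (t j ^ (d j - M j) * ((d j).choose (M j) : R))) := by
  simp_rw [X_pow_mul_X_add_C_pow]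
  rw [Finset.prod_univ_sum]
  refine Finset.sum_congr rfl fun M _ => ?_
  rw [prod_monomial, Finset.sum_add_distrib, Finsupp.single_finsetSum]
  congr 2
  ext k
  simp [Finsupp.single_apply]

/-- Collapsing the sum of the coefficients of those monomials at a fixed exponent `e`. [folklore] -/
theorem sum_piFinset_ite_eq (i : σ) (N : ℕ) (d : σ → ℕ) (e : σ →₀ ℕ) (r : σ → ℕ → R)
    (hr : ∀ j m, d j < m → r j m = 0) :
    (∑ M ∈ Fintype.piFinset (fun j => Finset.range (d j + 1)),
      if e = Finsupp.single i N + Finsupp.equivFunOnFinite.symm M then ∏ j, r j (M j) else 0) =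
      if N ≤ e i then ∏ j, r j ((e - Finsupp.single i N) j) else 0 := by
  by_cases hN : N ≤ e i
  · rw [if_pos hN]
    have key : ∀ M : σ → ℕ, (e = Finsupp.single i N + Finsupp.equivFunOnFinite.symm M) ↔
        M = ⇑(e - Finsupp.single i N) := by
      intro M
      constructor
      · intro h
        rw [h, add_tsub_cancel_left, Finsupp.coe_equivFunOnFinite_symm]
      · intro h
        rw [h, Finsupp.equivFunOnFinite_symm_coe,
          add_tsub_cancel_of_le (Finsupp.single_le_iff.mpr hN)]
    simp_rw [key]
    rw [Finset.sum_ite_eq']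
    split_ifs with hmem
    · rfl
    · rw [Fintype.mem_piFinset, not_forall] at hmem
      obtain ⟨j, hj⟩ := hmem
      rw [Finset.mem_range, not_lt, Nat.add_one_le_iff] at hj
      exact (Finset.prod_eq_zero (Finset.mem_univ j) (hr j _ hj)).symm
  · rw [if_neg hN]
    refine Finset.sum_eq_zero fun M _ => if_neg fun h => hN ?_
    rw [h]
    simp

/-- The coefficient of `∏_j (X_i^{β_j} (X_j + t_j))^{d_j}` at `e`, in closed form: with
`N = Σ β_j d_j`, it vanishes unless `N ≤ e_i`, and then it is
`∏_j t_j^{d_j - e'_j} (d_j choose e'_j)` for `e' = e - N • e_i`. [folklore] -/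
theorem coeff_prod_X_pow_mul_X_add_C_pow (i : σ) (β : σ → ℕ) (t : σ → R) (d : σ → ℕ)
    (e : σ →₀ ℕ) :
    coeff e (∏ j, ((X i : MvPowerSeries σ R) ^ β j * (X j + C (t j))) ^ d j) =
      if (∑ j, β j * d j) ≤ e i then
        ∏ j, (t j ^ (d j - (e - Finsupp.single i (∑ j, β j * d j)) j) *
          ((d j).choose ((e - Finsupp.single i (∑ j, β j * d j)) j) : R)) else 0 := by
  rw [prod_X_pow_mul_X_add_C_pow, map_sum]
  simp_rw [coeff_monomial]
  exact sum_piFinset_ite_eq i _ d e (fun j m => t j ^ (d j - m) * ((d j).choose m : R))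
    (fun j m hm => by rw [Nat.choose_eq_zero_of_lt hm, Nat.cast_zero, mul_zero])

end Monomials

section Key

variable {n : ℕ} {κ : Type} [Field κ]

/-- B's substitution family `u_i ↦ u_i`, `u_j ↦ u_i (u_j + τ_j)` (`j ∈ F ∖ i`), `u_k ↦ u_k`, written
uniformly as `j ↦ X_i^{β_j} (X_j + t_j)` with `β = 𝟙_{F∖i}`, `t = τ · 𝟙_{F∖i}`. [folklore] -/
theorem substFamily_eq (F : Finset (Fin n)) (i : Fin n) (τ : Fin n → κ) :
    (fun j : Fin n => if j = i then (X i : MvPowerSeries (Fin n) κ)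
        else if j ∈ F then X i * (X j + C (τ j)) else X j) =
      fun j => X i ^ (if j ∈ F.erase i then 1 else 0) *
        (X j + C (if j ∈ F.erase i then τ j else 0)) := by
  funext j
  by_cases hj : j = i
  · subst hj; simp
  · by_cases hjF : j ∈ F <;> simp [Finset.mem_erase, hj, hjF]

/-- The uniform family is substitutable (zero constant coefficients). [folklore] -/
theorem hasSubst_family (F : Finset (Fin n)) (i : Fin n) (τ : Fin n → κ) :
    HasSubst (fun j : Fin n => (X i : MvPowerSeries (Fin n) κ) ^ (if j ∈ F.erase i then 1 else 0) *
        (X j + C (if j ∈ F.erase i then τ j else 0))) :=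
  hasSubst_of_constantCoeff_zero fun j => by by_cases hj : j ∈ F.erase i <;> simp [hj]

/-- `Σ_j 𝟙_{E}(j) d_j = Σ_{j ∈ E} d_j`. [folklore] -/
theorem sum_indicator_mul (E : Finset (Fin n)) (d : Fin n → ℕ) :
    ∑ j, (if j ∈ E then 1 else 0) * d j = ∑ j ∈ E, d j := by
  simp_rw [boole_mul]
  exact Fintype.sum_ite_mem E d

/-- One summand of the translation move, evaluated on `dv ∘ bl`: for `D` supported on `F ∖ i` it is
`coeff_{A_D} φ` times the coefficient at `B + s e_i` of `∏_j a_j^{(A_D)_j}`. [folklore] -/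
theorem dv_bl_mul_prod_eq (F : Finset (Fin n)) (i : Fin n) (τ : Fin n → κ) (s : ℕ)
    (φ : MvPowerSeries (Fin n) κ) (B D : Fin n → ℕ) (hD : ∀ j, j ∉ F.erase i → D j = 0) :
    dv i s (bl F i (fun A : Fin n → ℕ => coeff (Finsupp.equivFunOnFinite.symm A) φ)) (B + D) *
        ∏ j ∈ F.erase i, ((((B j + D j).choose (B j) : ℕ) : κ) * τ j ^ D j) =
      coeff (Finsupp.equivFunOnFinite.symm
          (Function.update (B + D) i (B i + s - ∑ j ∈ F.erase i, (B j + D j)))) φ *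
        coeff (Finsupp.equivFunOnFinite.symm B + Finsupp.single i s)
          (∏ j, ((X i : MvPowerSeries (Fin n) κ) ^ (if j ∈ F.erase i then 1 else 0) *
            (X j + C (if j ∈ F.erase i then τ j else 0))) ^
            (Finsupp.equivFunOnFinite.symm
              (Function.update (B + D) i (B i + s - ∑ j ∈ F.erase i, (B j + D j)))) j) := by
  have hiE : i ∉ F.erase i := Finset.notMem_erase i F
  have hne : ∀ j ∈ F.erase i, j ≠ i := fun j hj => Finset.ne_of_mem_erase hj
  have hDi : D i = 0 := hD i hiE
  set T := ∑ j ∈ F.erase i, (B j + D j) with hT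
  set A : Fin n → ℕ := Function.update (B + D) i (B i + s - T) with hA
  have hAi : A i = B i + s - T := by simp [A]
  have hAj : ∀ j, j ≠ i → A j = B j + D j := fun j hj => by simp [A, hj]
  simp only [Finsupp.coe_equivFunOnFinite_symm]
  have hNA : ∑ j, (if j ∈ F.erase i then 1 else 0) * A j = T := by
    rw [sum_indicator_mul]
    exact Finset.sum_congr rfl fun j hj => hAj j (hne j hj)
  have hei : (Finsupp.equivFunOnFinite.symm B + Finsupp.single i s) i = B i + s := by simp
  have hM0i : (Finsupp.equivFunOnFinite.symm B + Finsupp.single i s - Finsupp.single i T) i =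
      B i + s - T := by simp
  have hM0j : ∀ j, j ≠ i →
      (Finsupp.equivFunOnFinite.symm B + Finsupp.single i s - Finsupp.single i T) j = B j := by
    intro j hj
    simp [Ne.symm hj]
  rw [coeff_prod_X_pow_mul_X_add_C_pow, hNA, hei]
  -- the left-hand side
  unfold dv bl
  have hT' : ∑ j ∈ F.erase i, Function.update (B + D) i ((B + D) i + s) j = T :=
    Finset.sum_congr rfl fun j hj => by rw [Function.update_of_ne (hne j hj), Pi.add_apply]
  rw [hT', Function.update_self, Function.update_idem, Pi.add_apply, hDi, add_zero, ← hA]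
  by_cases hle : T ≤ B i + s
  · rw [if_pos hle, if_pos hle]
    congr 1
    rw [← Finset.prod_subset (Finset.subset_univ (F.erase i)) ?_]
    · refine Finset.prod_congr rfl fun j hj => ?_
      have hj' := hne j hj
      rw [if_pos hj, hM0j j hj', hAj j hj', add_tsub_cancel_left, mul_comm]
    · intro j _ hj
      rw [if_neg hj]
      by_cases hji : j = i
      · subst hji
        rw [hM0i, hAi, Nat.sub_self, pow_zero, Nat.choose_self, Nat.cast_one, one_mul]
      · rw [hM0j j hji, hAj j hji, hD j hj, add_zero, Nat.sub_self, pow_zero, Nat.choose_self,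
          Nat.cast_one, one_mul]
  · rw [if_neg hle, if_neg hle, zero_mul, mul_zero]

/-- Support of the substitution sum: if the coefficient at `B + s e_i` of `∏_j a_j^{d_j}` is
non-zero, then `d = A_D` for some `D` supported on `F ∖ i` with all `D_j ≤ B_i + s`. [folklore] -/
theorem exists_of_coeff_prod_ne_zero (F : Finset (Fin n)) (i : Fin n) (τ : Fin n → κ) (s : ℕ)
    (B : Fin n → ℕ) (d : Fin n →₀ ℕ)
    (hd : coeff (Finsupp.equivFunOnFinite.symm B + Finsupp.single i s)
      (∏ j, ((X i : MvPowerSeries (Fin n) κ) ^ (if j ∈ F.erase i then 1 else 0) *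
        (X j + C (if j ∈ F.erase i then τ j else 0))) ^ d j) ≠ 0) :
    ∃ D : Fin n → ℕ, D ∈ (Fintype.piFinset fun _ : Fin n => Finset.range (B i + s + 1)).filter
        (fun D => ∀ j, j ∉ F.erase i → D j = 0) ∧
      Finsupp.equivFunOnFinite.symm
        (Function.update (B + D) i (B i + s - ∑ j ∈ F.erase i, (B j + D j))) = d := by
  have hiE : i ∉ F.erase i := Finset.notMem_erase i F
  have hne : ∀ j ∈ F.erase i, j ≠ i := fun j hj => Finset.ne_of_mem_erase hj
  rw [coeff_prod_X_pow_mul_X_add_C_pow, sum_indicator_mul] at hd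
  set N := ∑ j ∈ F.erase i, d j with hN
  have hei : (Finsupp.equivFunOnFinite.symm B + Finsupp.single i s) i = B i + s := by simp
  have hM0i : (Finsupp.equivFunOnFinite.symm B + Finsupp.single i s - Finsupp.single i N) i =
      B i + s - N := by simp
  have hM0j : ∀ j, j ≠ i →
      (Finsupp.equivFunOnFinite.symm B + Finsupp.single i s - Finsupp.single i N) j = B j := by
    intro j hj
    simp [Ne.symm hj]
  rw [hei] at hd
  by_cases hle : N ≤ B i + s
  swap
  · exact absurd (if_neg hle) hd
  rw [if_pos hle] at hd
  have hfac := Finset.prod_ne_zero_iff.mp hd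
  have h1 : ∀ j,
      (Finsupp.equivFunOnFinite.symm B + Finsupp.single i s - Finsupp.single i N) j ≤ d j := by
    intro j
    by_contra hlt
    exact hfac j (Finset.mem_univ j)
      (by rw [Nat.choose_eq_zero_of_lt (not_le.mp hlt), Nat.cast_zero, mul_zero])
  have h2 : ∀ j, j ∉ F.erase i →
      d j = (Finsupp.equivFunOnFinite.symm B + Finsupp.single i s - Finsupp.single i N) j := by
    intro j hj
    refine le_antisymm (not_lt.mp fun hlt => hfac j (Finset.mem_univ j) ?_) (h1 j)
    rw [if_neg hj, zero_pow (Nat.sub_ne_zero_of_lt hlt), zero_mul]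
  have hBj : ∀ j ∈ F.erase i, B j ≤ d j := fun j hj => by
    have := h1 j
    rwa [hM0j j (hne j hj)] at this
  have hdi : d i = B i + s - N := by rw [h2 i hiE, hM0i]
  have hdj : ∀ j, j ∉ F.erase i → j ≠ i → d j = B j := fun j hj hji => by
    rw [h2 j hj, hM0j j hji]
  have hsum : ∑ k ∈ F.erase i, (B k + (if k ∈ F.erase i then d k - B k else 0)) = N := by
    refine Finset.sum_congr rfl fun k hk => ?_
    rw [if_pos hk]
    exact Nat.add_sub_cancel' (hBj k hk)
  refine ⟨fun j => if j ∈ F.erase i then d j - B j else 0, ?_, ?_⟩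
  · rw [Finset.mem_filter, Fintype.mem_piFinset]
    refine ⟨fun j => Finset.mem_range.mpr ?_, fun j hj => if_neg hj⟩
    split_ifs with hj
    · have : d j ≤ N := Finset.single_le_sum (fun k _ => Nat.zero_le (d k)) hj
      omega
    · omega
  · ext j
    simp only [Finsupp.coe_equivFunOnFinite_symm]
    by_cases hji : j = i
    · subst hji
      rw [Function.update_self, hsum, hdi]
    · rw [Function.update_of_ne hji, Pi.add_apply]
      by_cases hj : j ∈ F.erase i
      · rw [if_pos hj]
        exact Nat.add_sub_cancel' (hBj j hj)
      · rw [if_neg hj, add_zero, hdj j hj hji]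

/-- `D ↦ A_D` is injective on the `D` supported on `F ∖ i`. [folklore] -/
theorem injOn_exponent (F : Finset (Fin n)) (i : Fin n) (s : ℕ) (B : Fin n → ℕ) :
    Set.InjOn (fun D : Fin n → ℕ => Finsupp.equivFunOnFinite.symm
        (Function.update (B + D) i (B i + s - ∑ j ∈ F.erase i, (B j + D j))))
      ↑((Fintype.piFinset fun _ : Fin n => Finset.range (B i + s + 1)).filter
        (fun D => ∀ j, j ∉ F.erase i → D j = 0)) := by
  intro D hD D' hD' h
  have hD2 := (Finset.mem_filter.mp (Finset.mem_coe.mp hD)).2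
  have hD2' := (Finset.mem_filter.mp (Finset.mem_coe.mp hD')).2
  funext j
  by_cases hj : j ∈ F.erase i
  · have hji : j ≠ i := Finset.ne_of_mem_erase hj
    have := DFunLike.congr_fun h j
    simp only [Finsupp.coe_equivFunOnFinite_symm, Function.update_of_ne hji, Pi.add_apply] at this
    omega
  · rw [hD2 j hj, hD2' j hj]

/-- (KEY) The composite move `tr ∘ dv_s ∘ bl` of the game, applied to the coefficient function of a
series `φ`, reads off the coefficient at `B + s e_i` of `φ(a)`, `a` being B's substitution
`u_i ↦ u_i`, `u_j ↦ u_i (u_j + τ_j)` (`j ∈ F ∖ i`), `u_k ↦ u_k` (`k ∉ F`). [folklore] -/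
theorem tr_dv_bl_apply (F : Finset (Fin n)) (i : Fin n) (τ : Fin n → κ) (s : ℕ)
    (φ : MvPowerSeries (Fin n) κ) (B : Fin n → ℕ) :
    tr F i τ s (dv i s (bl F i (fun A : Fin n → ℕ => coeff (Finsupp.equivFunOnFinite.symm A) φ)))
        B =
      coeff (Finsupp.equivFunOnFinite.symm B + Finsupp.single i s)
        (subst (fun j : Fin n => if j = i then (X i : MvPowerSeries (Fin n) κ)
          else if j ∈ F then X i * (X j + C (τ j)) else X j) φ) := by
  rw [substFamily_eq, coeff_subst (hasSubst_family F i τ)]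
  simp_rw [Finsupp.prod_pow, smul_eq_mul]
  rw [finsum_eq_sum_of_support_subset _
    (s := ((Fintype.piFinset fun _ : Fin n => Finset.range (B i + s + 1)).filter
      (fun D => ∀ j, j ∉ F.erase i → D j = 0)).image (fun D : Fin n → ℕ =>
        Finsupp.equivFunOnFinite.symm
          (Function.update (B + D) i (B i + s - ∑ j ∈ F.erase i, (B j + D j))))) ?_]
  · rw [Finset.sum_image (injOn_exponent F i s B), Finset.sum_filter]
    unfold tr
    refine Finset.sum_congr rfl fun D _ => ?_
    by_cases hsupp : ∀ j, j ∉ F.erase i → D j = 0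
    · rw [if_pos hsupp, if_pos hsupp]
      exact dv_bl_mul_prod_eq F i τ s φ B D hsupp
    · rw [if_neg hsupp, if_neg hsupp]
  · intro d hd
    rw [Function.mem_support] at hd
    obtain ⟨D, hD, hDd⟩ := exists_of_coeff_prod_ne_zero F i τ s B d (right_ne_zero_of_mul hd)
    rw [Finset.coe_image]
    exact ⟨D, hD, hDd⟩

end Key

/-- STUB S8 (dictionary): one move of the game IS "substitute, divide by `u_i^s`, clean".  For a
clean series `f` (no coefficient on `pℕ³`) and `s = p ⌊m_F / p⌋`, if the substituted series factors
as `u_i^s · g` then `step` returns the cleaning of `g`. [folklore] -/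
theorem stub_dictionary (p : ℕ) [Fact p.Prime] (κ : Type) [Field κ] [CharP κ p] (F : Finset (Fin 3))
    (i : Fin 3) (_hi : i ∈ F) (τ : Fin 3 → κ)
    (f g : MvPowerSeries (Fin 3) κ)
    (hclean : ∀ d : Fin 3 →₀ ℕ, (∀ j, p ∣ d j) → coeff d f = 0)
    (s : ℕ)
    (hs : s = p * (mF F (fun A : Fin 3 → ℕ => coeff (Finsupp.equivFunOnFinite.symm A) f) / p))
    (hfac : subst (fun j : Fin 3 => if j = i then (X i : MvPowerSeries (Fin 3) κ)
        else if j ∈ F then X i * (X j + C (τ j)) else X j) f = X i ^ s * g) :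
    step p F i τ (fun A : Fin 3 → ℕ => coeff (Finsupp.equivFunOnFinite.symm A) f) =
      clean p (fun A : Fin 3 → ℕ => coeff (Finsupp.equivFunOnFinite.symm A) g) := by
  have hcl : clean p (fun A : Fin 3 → ℕ => coeff (Finsupp.equivFunOnFinite.symm A) f) =
      fun A => coeff (Finsupp.equivFunOnFinite.symm A) f := by
    funext A
    unfold clean
    split_ifs with h
    · exact (hclean _ fun j => h j).symm
    · rfl
  unfold step
  rw [hcl, ← hs]
  congr 1
  funext B
  rw [tr_dv_bl_apply, hfac, X_pow_eq, add_comm (Finsupp.equivFunOnFinite.symm B),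
    coeff_add_monomial_mul, one_mul]

end Summit.ResolutionOfSingularities.ResolutionOfSingularities.Theorems.ShadowGameWinR.Negative

end
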